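import Literature.NumberTheory.GaloisRepresentations.AbsIntegersValuationSubringsMaximalIdeals
import Literature.NumberTheory.GaloisRepresentations.IntegralGaloisActionProofs
import Mathlib.RingTheory.Polynomial.Eisenstein.Criterion
import Mathlib.RingTheory.Polynomial.GaussLemma
import Mathlib.FieldTheory.Normal.Basic
import HarnessLib

/-!
# Decomposition groups of the finite places of `K̄` are INFINITE and PROPER

Topic `Literature/NumberTheory/GaloisRepresentations` (continues `AbsIntegersValuationSubringsMaximalIdeals`,
`IntegralGaloisActionProofs`).  Let `K` be a number field, `K̄ = AlgebraicClosure K`, `G_K = Gal(K̄/K)`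
(`Field.absoluteGaloisGroup K`), `ℤ̄ = absIntegers (𝓞 K) K` the ring of algebraic integers of `K̄`.  For a maximal
ideal `𝔓` of `ℤ̄` (equivalently — `maximalSpectrumEquivValuationSubring` — a non-trivial valuation ring `A` of `K̄`,
i.e. a finite place of `K̄`) the decomposition group `D_𝔓 = Stab_{G_K}(𝔓)` (`= Stab_{G_K}(A)`,
`stabilizer_eq_stabilizer_absIntegersCentre`) satisfies the two classical facts (Neukirch, *Algebraic Number
Theory*, Ch. II §9: `D_𝔓 ≅ Gal(K̄_𝔓/K_𝔭)`, an infinite proper closed subgroup):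

* `absIntegers.infinite_stabilizer` — **`D_𝔓` is infinite**: a Frobenius `σ ∈ D_𝔓` exists
  (`exists_isArithFrobAt_of_mem_primesAbove_holds`) and its powers are pairwise distinct, because `σ^k = 1`
  (`k ≥ 1`) would force `x^(q^k) ≡ x (mod 𝔓)` for EVERY `x ∈ ℤ̄`, which a root of `X^Q − X − 1` refutes
  (`absIntegers.exists_pow_sub_notMem`);
* `absIntegers.stabilizer_ne_top` — **`D_𝔓 ≠ G_K`**: with `𝔭 = 𝔓 ∩ 𝓞 K`, a second prime `𝔮 ≠ 𝔭` of `𝓞 K`,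
  `a ∈ 𝔮 ∖ 𝔭` and `b ∈ 𝔭𝔮 ∖ 𝔮²`, the polynomial `X² + aX + b` is irreducible over `K` (Eisenstein at `𝔮`, Gauss)
  and its roots `α₁, α₂ ∈ ℤ̄` satisfy `α₁α₂ = b ∈ 𝔓`, `α₁ + α₂ = −a ∉ 𝔓`; so exactly one of them lies in `𝔓`
  and the `σ ∈ G_K` interchanging them (`minpoly.exists_algEquiv_of_root`) moves `𝔓`;
* `ValuationSubring.infinite_stabilizer_of_ne_top`, `ValuationSubring.stabilizer_ne_top_of_ne_top` — the same two
  facts for the stabiliser of a non-trivial valuation ring `A` of `K̄`.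

abc-iut cell use (seat abc-iut-f-053 gen 3, row «P51-SNON-GENUINE»): these are the hypotheses (S_non) «`G_v`
infinite for nonarchimedean `v`» and the nonarchimedean half of (S⊚) «`G_v ≠ G_F`» of [AbsTopIII] Def 5.1 /
Cor 5.2 (v) at the genuine pro-set `V⊚(F̄/F)` (`PanalocalTheatersStructural.lean`).  Classical algebraic number
theory; theorems only, no new definitions; nothing here bears on [IUTchIII] Cor. 3.12.
-/

noncomputable section

open scoped NumberField Pointwise Polynomial

namespace Literature.NumberTheory.GaloisRepresentations

open Field Polynomial IsDedekindDomain

-- as in `AbsIntegersLocalization`: the pointwise `G_K`-actions on `ℤ̄` and on its ideals are found slowly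
set_option synthInstance.maxHeartbeats 160000

variable {K : Type*} [Field K]

/-! ### §1. No identity `x^Q ≡ x (mod 𝔓)` holds on all of `ℤ̄` -/

/-- For `Q ≥ 2` the polynomial `X^Q − X − 1` over any nontrivial ring is monic of degree `Q`.
[cite: NeukirchANT1999, Ch. II §9] -/
theorem monic_X_pow_sub_X_sub_one {R : Type*} [CommRing R] [Nontrivial R] {Q : ℕ} (hQ : 2 ≤ Q) :
    (X ^ Q - X - 1 : R[X]).Monic ∧ (X ^ Q - X - 1 : R[X]).natDegree = Q := by
  have heq : (X ^ Q - X - 1 : R[X]) = X ^ Q - (X + C 1) := by rw [C_1]; ring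
  have hnat : (X + C 1 : R[X]).natDegree < (X ^ Q : R[X]).natDegree := by
    rw [natDegree_X_add_C, natDegree_X_pow]; omega
  have hdeg : (X + C 1 : R[X]).degree < (X ^ Q : R[X]).degree := by
    rw [degree_X_add_C, degree_X_pow]; exact_mod_cast (by omega : 1 < Q)
  rw [heq]
  exact ⟨(monic_X_pow Q).sub_of_left hdeg, by rw [natDegree_sub_eq_left_of_natDegree_lt hnat, natDegree_X_pow]⟩

/-- **No Frobenius-type identity holds universally modulo a proper ideal of `ℤ̄`**: for every ideal `𝔓 ≠ ℤ̄`
of the algebraic integers of `K̄` and every exponent `Q ≥ 2` some `x ∈ ℤ̄` has `x^Q − x ∉ 𝔓` — namely a root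
`x ∈ K̄` of `X^Q − X − 1` (an algebraic integer with `x^Q − x = 1`).  (The residue field `ℤ̄/𝔓` is an
algebraic closure of `𝔽_p`, in particular infinite.) [cite: NeukirchANT1999, Ch. II §9] -/
theorem absIntegers.exists_pow_sub_notMem {R : Type*} [CommRing R] [Algebra R K]
    {𝔓 : Ideal (absIntegers R K)} (h𝔓 : 𝔓 ≠ ⊤) {Q : ℕ} (hQ : 2 ≤ Q) :
    ∃ x : absIntegers R K, x ^ Q - x ∉ 𝔓 := by
  obtain ⟨hmon, hnat⟩ := monic_X_pow_sub_X_sub_one (R := AlgebraicClosure K) hQ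
  have hdeg : (X ^ Q - X - 1 : (AlgebraicClosure K)[X]).degree ≠ 0 := by
    rw [degree_eq_natDegree hmon.ne_zero, hnat]
    exact_mod_cast (by omega : Q ≠ 0)
  obtain ⟨α, hα⟩ := IsAlgClosed.exists_root _ hdeg
  have hα' : α ^ Q - α = 1 := by
    rw [IsRoot.def, eval_sub, eval_sub, eval_pow, eval_X, eval_one] at hα
    exact sub_eq_zero.mp hα
  -- `α` is integral over `ℤ` (a root of the monic `X^Q − X − 1 ∈ ℤ[X]`), hence over `R`
  have hintZ : IsIntegral ℤ α := by
    obtain ⟨hmonZ, -⟩ := monic_X_pow_sub_X_sub_one (R := ℤ) hQ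
    refine ⟨X ^ Q - X - 1, hmonZ, ?_⟩
    rw [eval₂_sub, eval₂_sub, eval₂_X_pow, eval₂_X, eval₂_one, hα', sub_self]
  have hint : IsIntegral R α := hintZ.tower_top
  set x : absIntegers R K := ⟨α, (mem_integralClosure_iff _ _).mpr hint⟩ with hx
  refine ⟨x, fun hmem => h𝔓 ?_⟩
  have h1 : x ^ Q - x = 1 := Subtype.ext (by simp [hx, hα'])
  rw [h1] at hmem
  exact (Ideal.eq_top_iff_one 𝔓).mpr hmem

/-! ### §2. Powers of a Frobenius; `D_𝔓` is infinite -/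

section Frobenius

variable {R S : Type*} [CommRing R] [CommRing S] [Algebra R S] {G : Type*} [Group G] [MulSemiringAction G S]
  [SMulCommClass G R S] {Q : Ideal S} {σ : G}

/-- **Powers of a Frobenius are Frobenii for the powers of `q`**: if `σ • x ≡ x^q (mod Q)` for all `x`
(`q = #(R/Q ∩ R)`, `Q` prime), then `σ^n • x ≡ x^(q^n) (mod Q)` for all `x` and all `n`.
[cite: NeukirchANT1999, Ch. I §9 Prop. (9.4)] -/
theorem IsArithFrobAt.pow_smul_sub_pow_pow_mem [Q.IsPrime] (h : IsArithFrobAt R σ Q) (n : ℕ) (x : S) :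
    σ ^ n • x - x ^ (Nat.card (R ⧸ Q.under R) ^ n) ∈ Q := by
  induction n generalizing x with
  | zero => simp
  | succ n ih =>
    have hstab : σ • Q = Q := IsArithFrobAt.mem_stabilizer h
    -- `σ^(n+1) • x − x^(q^(n+1)) = σ • (σ^n • x − x^(q^n)) + ((σ • x)^(q^n) − (x^q)^(q^n))`
    have h1 : σ • (σ ^ n • x - x ^ (Nat.card (R ⧸ Q.under R) ^ n)) ∈ Q := by
      have h1' : σ • (σ ^ n • x - x ^ (Nat.card (R ⧸ Q.under R) ^ n)) ∈ σ • Q :=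
        Ideal.smul_mem_pointwise_smul_iff.mpr (ih x)
      rwa [hstab] at h1' 
    have h2 : (σ • x) ^ (Nat.card (R ⧸ Q.under R) ^ n) - (x ^ Nat.card (R ⧸ Q.under R)) ^
        (Nat.card (R ⧸ Q.under R) ^ n) ∈ Q := by
      obtain ⟨c, hc⟩ := sub_dvd_pow_sub_pow (σ • x) (x ^ Nat.card (R ⧸ Q.under R)) (Nat.card (R ⧸ Q.under R) ^ n)
      rw [hc]
      exact Q.mul_mem_right c (h x)
    have heq : σ ^ (n + 1) • x - x ^ (Nat.card (R ⧸ Q.under R) ^ (n + 1)) =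
        σ • (σ ^ n • x - x ^ (Nat.card (R ⧸ Q.under R) ^ n)) +
          ((σ • x) ^ (Nat.card (R ⧸ Q.under R) ^ n) -
            (x ^ Nat.card (R ⧸ Q.under R)) ^ (Nat.card (R ⧸ Q.under R) ^ n)) := by
      rw [pow_succ', mul_smul, smul_sub, smul_pow', ← pow_mul, pow_succ]
      ring
    rw [heq]
    exact Q.add_mem h1 h2

end Frobenius

end Literature.NumberTheory.GaloisRepresentations

namespace Literature.NumberTheory.GaloisRepresentations

open Field Polynomial IsDedekindDomain

set_option synthInstance.maxHeartbeats 160000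

variable {K : Type*} [Field K]

/-- **`D_𝔓` is infinite** for every maximal ideal `𝔓` of the algebraic integers `ℤ̄ ⊆ K̄` of a number field `K`:
a Frobenius `σ ∈ D_𝔓` exists (`exists_isArithFrobAt_of_mem_primesAbove_holds`) and `n ↦ σ^n` is injective —
`σ^k = 1` with `k ≥ 1` would give `x^(q^k) ≡ x (mod 𝔓)` on all of `ℤ̄`, refuted by
`absIntegers.exists_pow_sub_notMem`. [cite: NeukirchANT1999, Ch. II §9] -/
theorem absIntegers.infinite_stabilizer [NumberField K] (𝔓 : Ideal (absIntegers (𝓞 K) K)) [h𝔓 : 𝔓.IsMaximal] :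
    (MulAction.stabilizer (absoluteGaloisGroup K) 𝔓 : Set (absoluteGaloisGroup K)).Infinite := by
  -- `𝔓` lies above the finite place `v = 𝔓 ∩ 𝓞 K` of `K`
  haveI : (𝔓.under (𝓞 K)).IsMaximal := Ideal.IsMaximal.under (𝓞 K) 𝔓
  have hne : 𝔓.under (𝓞 K) ≠ ⊥ := Ring.ne_bot_of_isMaximal_of_not_isField inferInstance
    (NumberField.RingOfIntegers.not_isField K)
  let v : HeightOneSpectrum (𝓞 K) := ⟨𝔓.under (𝓞 K), Ideal.IsMaximal.isPrime inferInstance, hne⟩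
  have hv : 𝔓 ∈ v.primesAbove := (HeightOneSpectrum.mem_primesAbove_iff).mpr ⟨h𝔓.isPrime, ⟨rfl⟩⟩
  obtain ⟨σ, hσ⟩ := HeightOneSpectrum.exists_isArithFrobAt_of_mem_primesAbove_holds hv
  have hq : 2 ≤ Nat.card (𝓞 K ⧸ 𝔓.under (𝓞 K)) := by
    rw [HeightOneSpectrum.card_quotient_under_eq_residueCard hv]
    exact v.one_lt_residueCard
  -- the powers of `σ` lie in `D_𝔓` and are pairwise distinct
  refine Set.infinite_of_injective_forall_mem (f := fun n : ℕ => σ ^ n) ?_ fun n =>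
    (MulAction.stabilizer (absoluteGaloisGroup K) 𝔓).pow_mem (IsArithFrobAt.mem_stabilizer hσ) n
  intro m n hmn
  by_contra hne'
  wlog hlt : m < n generalizing m n
  · exact this hmn.symm (Ne.symm hne') (lt_of_le_of_ne (not_lt.mp hlt) (Ne.symm hne'))
  have hk : σ ^ (n - m) = 1 := by
    have : σ ^ m * σ ^ (n - m) = σ ^ m * 1 := by rw [← pow_add, Nat.add_sub_cancel' hlt.le, mul_one]; exact hmn.symm
    exact mul_left_cancel this
  have hQ : 2 ≤ Nat.card (𝓞 K ⧸ 𝔓.under (𝓞 K)) ^ (n - m) :=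
    le_trans hq (Nat.le_self_pow (by omega) _)
  obtain ⟨x, hx⟩ := absIntegers.exists_pow_sub_notMem (K := K) h𝔓.ne_top hQ
  have hmem := IsArithFrobAt.pow_smul_sub_pow_pow_mem hσ (n - m) x
  rw [hk, one_smul] at hmem
  exact hx (by simpa using 𝔓.neg_mem hmem)

/-! ### §3. `D_𝔓 ≠ G_K`: an explicit pair of conjugates separated by `𝔓` -/

section Proper

variable [NumberField K]

/-- For every maximal ideal `𝔭` of `𝓞 K` there is a maximal ideal `𝔮 ≠ 𝔭` (one of the rational primes `2, 3`
is not in `𝔭`; take `𝔮` above it). [cite: NeukirchANT1999, Ch. I §8] -/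
theorem RingOfIntegers.exists_isMaximal_ne (𝔭 : Ideal (𝓞 K)) [h𝔭 : 𝔭.IsMaximal] :
    ∃ 𝔮 : Ideal (𝓞 K), 𝔮.IsMaximal ∧ 𝔮 ≠ 𝔭 := by
  -- a rational prime `ℓ ∉ 𝔭`: not both `2, 3 ∈ 𝔭` (else `1 = 3 − 2 ∈ 𝔭`)
  have key : ∀ ℓ : ℕ, ℓ.Prime → ((ℓ : ℤ) : 𝓞 K) ∉ 𝔭 → ∃ 𝔮 : Ideal (𝓞 K), 𝔮.IsMaximal ∧ 𝔮 ≠ 𝔭 := by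
    intro ℓ hℓ hℓ𝔭
    haveI : (Ideal.span {(ℓ : ℤ)}).IsMaximal :=
      (Ideal.span_singleton_prime (by exact_mod_cast hℓ.ne_zero)).mpr (Nat.prime_iff_prime_int.mp hℓ)
        |>.isMaximal (by simpa using hℓ.ne_zero)
    obtain ⟨𝔮, h𝔮max, h𝔮over⟩ :=
      Ideal.exists_ideal_over_maximal_of_isIntegral (S := 𝓞 K) (Ideal.span {(ℓ : ℤ)}) (by
        rw [(RingHom.injective_iff_ker_eq_bot _).mp (by exact Int.cast_injective)]; exact bot_le)
    refine ⟨𝔮, h𝔮max, fun h => hℓ𝔭 ?_⟩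
    rw [← h]
    have hmem : (ℓ : ℤ) ∈ 𝔮.comap (algebraMap ℤ (𝓞 K)) := by
      rw [h𝔮over]; exact Ideal.mem_span_singleton_self _
    simpa [Ideal.mem_comap] using hmem
  by_cases h2 : ((2 : ℕ) : ℤ) ∈ (𝔭.under ℤ)
  · refine key 3 Nat.prime_three fun h3 => h𝔭.ne_top ((Ideal.eq_top_iff_one _).mpr ?_)
    have h2' : (((2 : ℕ) : ℤ) : 𝓞 K) ∈ 𝔭 := by simpa [Ideal.under_def, Ideal.mem_comap] using h2
    have := 𝔭.sub_mem h3 h2'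
    push_cast at this
    norm_num at this
    exact this
  · exact key 2 Nat.prime_two fun h => h2 (by simpa [Ideal.under_def, Ideal.mem_comap] using h)

/-- For maximal ideals `𝔮 ≠ 𝔭` of the Dedekind domain `𝓞 K`: some `a ∈ 𝔮 ∖ 𝔭` and some `b ∈ 𝔭𝔮 ∖ 𝔮²` exist
(`𝔭𝔮 ⊆ 𝔮²` would force `𝔮 ∣ 𝔭`, i.e. `𝔭 = 𝔮`). [cite: NeukirchANT1999, Ch. I §3] -/
theorem RingOfIntegers.exists_mem_sdiff_of_isMaximal_ne {𝔭 𝔮 : Ideal (𝓞 K)} [h𝔭 : 𝔭.IsMaximal]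
    [h𝔮 : 𝔮.IsMaximal] (hne : 𝔮 ≠ 𝔭) :
    (∃ a : 𝓞 K, a ∈ 𝔮 ∧ a ∉ 𝔭) ∧ ∃ b : 𝓞 K, b ∈ 𝔭 * 𝔮 ∧ b ∉ 𝔮 ^ 2 := by
  constructor
  · have h : ¬ (𝔮 ≤ 𝔭) := fun hle => hne (h𝔮.eq_of_le h𝔭.ne_top hle)
    obtain ⟨a, ha𝔮, ha𝔭⟩ := Set.not_subset.mp (show ¬ ((𝔮 : Set (𝓞 K)) ⊆ 𝔭) from h)
    exact ⟨a, ha𝔮, ha𝔭⟩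
  · have h𝔮0 : 𝔮 ≠ ⊥ := Ring.ne_bot_of_isMaximal_of_not_isField h𝔮 (NumberField.RingOfIntegers.not_isField K)
    have h : ¬ (𝔭 * 𝔮 ≤ 𝔮 ^ 2) := by
      intro hle
      have hdvd : 𝔮 * 𝔮 ∣ 𝔮 * 𝔭 := by rw [← sq, mul_comm 𝔮 𝔭]; exact Ideal.dvd_iff_le.mpr hle
      have h' : 𝔭 ≤ 𝔮 := Ideal.dvd_iff_le.mp ((mul_dvd_mul_iff_left h𝔮0).mp hdvd)
      exact hne (h𝔭.eq_of_le h𝔮.ne_top h').symm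
    obtain ⟨b, hb, hb'⟩ := Set.not_subset.mp (show ¬ ((𝔭 * 𝔮 : Ideal (𝓞 K)) : Set (𝓞 K)) ⊆ (𝔮 ^ 2 : Ideal (𝓞 K))
      from h)
    exact ⟨b, hb, hb'⟩

/-- **The Eisenstein pair.**  For a maximal ideal `𝔭` of `𝓞 K` there are algebraic integers `α₁, α₂ ∈ ℤ̄ ⊆ K̄`,
CONJUGATE over `K` (`σ α₂ = α₁` for some `σ ∈ Gal(K̄/K)`), with `α₁ α₂ ∈ 𝔭ℤ̄`-image of some `b ∈ 𝔭` and
`α₁ + α₂ = −a` for some `a ∈ 𝓞 K ∖ 𝔭`: the roots of `X² + aX + b`, `a ∈ 𝔮 ∖ 𝔭`, `b ∈ 𝔭𝔮 ∖ 𝔮²`, which is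
irreducible over `K` by Eisenstein's criterion at `𝔮` and Gauss's lemma. [cite: NeukirchANT1999, Ch. II §9] -/
theorem absIntegers.exists_conjugate_pair (𝔭 : Ideal (𝓞 K)) [h𝔭 : 𝔭.IsMaximal] :
    ∃ (a b : 𝓞 K) (x₁ x₂ : absIntegers (𝓞 K) K) (σ : absoluteGaloisGroup K),
      a ∉ 𝔭 ∧ b ∈ 𝔭 ∧ x₁ * x₂ = algebraMap (𝓞 K) (absIntegers (𝓞 K) K) b ∧
        x₁ + x₂ = -algebraMap (𝓞 K) (absIntegers (𝓞 K) K) a ∧ σ • x₂ = x₁ := by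
  obtain ⟨𝔮, h𝔮, hne⟩ := RingOfIntegers.exists_isMaximal_ne 𝔭
  obtain ⟨⟨a, ha𝔮, ha𝔭⟩, ⟨b, hb, hb𝔮⟩⟩ := RingOfIntegers.exists_mem_sdiff_of_isMaximal_ne (K := K) hne
  -- the polynomial `g = X² + aX + b` over `𝓞 K`: monic, Eisenstein at `𝔮`, hence irreducible over `K`
  set g : (𝓞 K)[X] := X ^ 2 + C a * X + C b with hg
  have hmon : g.Monic := by rw [hg]; monicity!
  have hnat : g.natDegree = 2 := by rw [hg]; compute_degree!
  have hdeg : g.degree = 2 := by rw [degree_eq_natDegree hmon.ne_zero, hnat]; rfl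
  have hc0 : g.coeff 0 = b := by simp [hg]
  have hc1 : g.coeff 1 = a := by simp [hg]
  have hirr : Irreducible g := by
    refine irreducible_of_eisenstein_criterion h𝔮.isPrime ?_ ?_ ?_ ?_ hmon.isPrimitive
    · rw [hmon.leadingCoeff]; exact fun h1 => h𝔮.ne_top ((Ideal.eq_top_iff_one _).mpr h1)
    · intro n hn
      rw [hdeg] at hn
      have hn' : n < 2 := by exact_mod_cast hn
      interval_cases n
      · rw [hc0]; exact Ideal.mul_le_left hb
      · rw [hc1]; exact ha𝔮
    · rw [hdeg]; norm_num
    · rw [hc0]; exact hb𝔮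
  have hirrK : Irreducible (g.map (algebraMap (𝓞 K) K)) :=
    (hmon.irreducible_iff_irreducible_map_fraction_map (K := K)).mp hirr
  have hmonK : (g.map (algebraMap (𝓞 K) K)).Monic := hmon.map _
  -- its roots `α₁`, `α₂ = −a − α₁` in `K̄`
  set a' : AlgebraicClosure K := algebraMap (𝓞 K) (AlgebraicClosure K) a with ha'
  set b' : AlgebraicClosure K := algebraMap (𝓞 K) (AlgebraicClosure K) b with hb'
  have haeval : ∀ z : AlgebraicClosure K, aeval z g = z ^ 2 + a' * z + b' := by
    intro z; simp [hg, ha', hb']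
  have hdeg' : (g.map (algebraMap (𝓞 K) (AlgebraicClosure K))).degree ≠ 0 := by
    rw [hmon.degree_map, hdeg]; norm_num
  obtain ⟨α₁, hα₁⟩ := IsAlgClosed.exists_root _ hdeg'
  have hα₁' : α₁ ^ 2 + a' * α₁ + b' = 0 := by
    rw [IsRoot.def, eval_map, ← aeval_def, haeval] at hα₁; exact hα₁
  set α₂ : AlgebraicClosure K := -a' - α₁ with hα₂
  have hα₂' : α₂ ^ 2 + a' * α₂ + b' = 0 := by
    rw [hα₂]; linear_combination hα₁'
  have hprod : α₁ * α₂ = b' := by rw [hα₂]; linear_combination -hα₁'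
  have hsum : α₁ + α₂ = -a' := by rw [hα₂]; ring
  -- both are integral over `𝓞 K` (roots of the monic `g`)
  have hint : ∀ z : AlgebraicClosure K, z ^ 2 + a' * z + b' = 0 → IsIntegral (𝓞 K) z := fun z hz =>
    ⟨g, hmon, by rw [← aeval_def, haeval, hz]⟩
  -- `α₁` and `α₂` are conjugate over `K`: `minpoly K α₁ = g`
  have hmin : g.map (algebraMap (𝓞 K) K) = minpoly K α₁ :=
    minpoly.eq_of_irreducible_of_monic hirrK (by rw [aeval_map_algebraMap, haeval, hα₁']) hmonK
  have hev : aeval α₂ (minpoly K α₁) = 0 := by rw [← hmin, aeval_map_algebraMap, haeval, hα₂']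
  obtain ⟨σ, hσ⟩ := minpoly.exists_algEquiv_of_root (Algebra.IsAlgebraic.isAlgebraic α₁) hev
  refine ⟨a, b, ⟨α₁, (mem_integralClosure_iff _ _).mpr (hint α₁ hα₁')⟩,
    ⟨α₂, (mem_integralClosure_iff _ _).mpr (hint α₂ hα₂')⟩, (absoluteGaloisGroup.toAlgEquiv K).symm σ,
    ha𝔭, Ideal.mul_le_right hb, Subtype.ext ?_, Subtype.ext ?_, Subtype.ext ?_⟩
  · exact hprod
  · exact hsum
  · rw [integralClosure.coe_smul]
    simpa using hσ

/-- **`D_𝔓 ≠ G_K`** for every maximal ideal `𝔓` of the algebraic integers `ℤ̄ ⊆ K̄` of a number field `K`: with the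
Eisenstein pair `α₁ α₂ = b ∈ 𝔓`, `α₁ + α₂ = −a ∉ 𝔓` (`absIntegers.exists_conjugate_pair` at `𝔭 = 𝔓 ∩ 𝓞 K`)
exactly one of `α₁, α₂` lies in `𝔓`, so the `σ ∈ G_K` with `σ α₂ = α₁` does not stabilise `𝔓`.
[cite: NeukirchANT1999, Ch. II §9] -/
theorem absIntegers.stabilizer_ne_top (𝔓 : Ideal (absIntegers (𝓞 K) K)) [h𝔓 : 𝔓.IsMaximal] :
    MulAction.stabilizer (absoluteGaloisGroup K) 𝔓 ≠ ⊤ := by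
  haveI : (𝔓.under (𝓞 K)).IsMaximal := Ideal.IsMaximal.under (𝓞 K) 𝔓
  obtain ⟨a, b, x₁, x₂, σ, ha, hb, hprod, hsum, hσ⟩ := absIntegers.exists_conjugate_pair (K := K) (𝔓.under (𝓞 K))
  intro htop
  have hstab : ∀ τ : absoluteGaloisGroup K, τ • 𝔓 = 𝔓 := fun τ =>
    MulAction.mem_stabilizer_iff.mp (htop ▸ Subgroup.mem_top τ)
  -- `x₁ x₂ = b ∈ 𝔓`, so one of them lies in `𝔓`; not both, since `x₁ + x₂ = −a ∉ 𝔓`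
  have hb' : x₁ * x₂ ∈ 𝔓 := by rw [hprod]; exact (Ideal.mem_comap.mp hb : _)
  have hnot : ¬ (x₁ ∈ 𝔓 ∧ x₂ ∈ 𝔓) := fun h => ha (by
    have hs : x₁ + x₂ ∈ 𝔓 := 𝔓.add_mem h.1 h.2
    rw [hsum] at hs
    exact Ideal.mem_comap.mpr (by simpa using 𝔓.neg_mem hs))
  -- moving along `σ` (`σ x₂ = x₁`) and `σ⁻¹` (`σ⁻¹ x₁ = x₂`) inside the `G_K`-stable `𝔓`
  have h21 : x₂ ∈ 𝔓 → x₁ ∈ 𝔓 := fun h2 => by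
    rw [← hσ, ← hstab σ]; exact Ideal.smul_mem_pointwise_smul_iff.mpr h2
  have h12 : x₁ ∈ 𝔓 → x₂ ∈ 𝔓 := fun h1 => by
    have : σ⁻¹ • x₁ = x₂ := by rw [← hσ, inv_smul_smul]
    rw [← this, ← hstab σ⁻¹]; exact Ideal.smul_mem_pointwise_smul_iff.mpr h1
  rcases h𝔓.isPrime.mem_or_mem hb' with h1 | h2
  · exact hnot ⟨h1, h12 h1⟩
  · exact hnot ⟨h21 h2, h2⟩

end Proper

/-! ### §4. The same for the stabiliser of a non-trivial valuation ring of `K̄` -/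

section ValuationRing

variable [NumberField K] (A : ValuationSubring (AlgebraicClosure K))

/-- **The decomposition group `Stab_{G_K}(A)` of a finite place of `K̄` (a valuation ring `A ≠ K̄`) is INFINITE**
(`= D_𝔓` for the centre `𝔓 = 𝔪_A ∩ ℤ̄`, a maximal ideal; `absIntegers.infinite_stabilizer`).
[cite: NeukirchANT1999, Ch. II §9] -/
theorem ValuationSubring.infinite_stabilizer_of_ne_top (hA : A ≠ ⊤) :
    (MulAction.stabilizer (absoluteGaloisGroup K) A : Set (absoluteGaloisGroup K)).Infinite := by
  haveI := absIntegersCentre_isMaximal A hA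
  rw [stabilizer_eq_stabilizer_absIntegersCentre A hA]
  exact absIntegers.infinite_stabilizer (absIntegersCentre A)

/-- **The decomposition group `Stab_{G_K}(A)` of a finite place of `K̄` (a valuation ring `A ≠ K̄`) is a PROPER
subgroup of `G_K`** (`absIntegers.stabilizer_ne_top` at the centre of `A`). [cite: NeukirchANT1999, Ch. II §9] -/
theorem ValuationSubring.stabilizer_ne_top_of_ne_top (hA : A ≠ ⊤) :
    MulAction.stabilizer (absoluteGaloisGroup K) A ≠ ⊤ := by
  haveI := absIntegersCentre_isMaximal A hA
  rw [stabilizer_eq_stabilizer_absIntegersCentre A hA]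
  exact absIntegers.stabilizer_ne_top (absIntegersCentre A)

/-- Hence some `σ ∈ G_K` MOVES the valuation ring: `σ • A ≠ A`. [cite: NeukirchANT1999, Ch. II §9] -/
theorem ValuationSubring.exists_smul_ne_of_ne_top (hA : A ≠ ⊤) : ∃ σ : absoluteGaloisGroup K, σ • A ≠ A := by
  by_contra h
  exact ValuationSubring.stabilizer_ne_top_of_ne_top A hA
    ((Subgroup.eq_top_iff' _).mpr fun σ => MulAction.mem_stabilizer_iff.mpr (not_not.mp (not_exists.mp h σ)))

/-- And some `σ ≠ 1` in `G_K` FIXES it: `σ • A = A`. [cite: NeukirchANT1999, Ch. II §9] -/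
theorem ValuationSubring.exists_ne_one_smul_eq_of_ne_top (hA : A ≠ ⊤) :
    ∃ σ : absoluteGaloisGroup K, σ ≠ 1 ∧ σ • A = A := by
  obtain ⟨σ, hσ, hne⟩ :=
    Set.Infinite.exists_notMem_finset (ValuationSubring.infinite_stabilizer_of_ne_top A hA) {1}
  exact ⟨σ, by simpa using hne, MulAction.mem_stabilizer_iff.mp hσ⟩

end ValuationRing

/-! ### Appendix (appended, abc-iut-f-053 gen 3): the residue rings `ℤ̄/𝔓` are infinite -/

section Residue

/-- **`ℤ̄/𝔓` is INFINITE for every proper ideal `𝔓` of the algebraic integers `ℤ̄` of `K̄`** (any field `K`, any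
base ring `R`): for a maximal `𝔐 ⊇ 𝔓` the field `ℤ̄/𝔐` cannot be finite of cardinality `Q`, since then `x^Q ≡ x`
for all `x ∈ ℤ̄` (`FiniteField.pow_card`), contradicting `absIntegers.exists_pow_sub_notMem`; and `ℤ̄/𝔓 ↠ ℤ̄/𝔐`.
(The residue field of `K̄` at a finite place is an algebraic closure of `𝔽_p`.) [cite: NeukirchANT1999, Ch. II §9] -/
theorem absIntegers.infinite_quotient {R : Type*} [CommRing R] [Algebra R K]
    (𝔓 : Ideal (absIntegers R K)) (h𝔓 : 𝔓 ≠ ⊤) : Infinite (absIntegers R K ⧸ 𝔓) := by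
  classical
  -- a maximal ideal `𝔐 ⊇ 𝔓`; `ℤ̄/𝔓 ↠ ℤ̄/𝔐`, so it suffices that the field `ℤ̄/𝔐` is infinite
  obtain ⟨𝔐, h𝔐, hle⟩ := Ideal.exists_le_maximal 𝔓 h𝔓
  haveI := h𝔐
  suffices hinf : Infinite (absIntegers R K ⧸ 𝔐) from
    Infinite.of_surjective (Ideal.Quotient.factor hle) (Ideal.Quotient.factor_surjective hle)
  rw [← not_finite_iff_infinite]
  intro hfin
  letI : Fintype (absIntegers R K ⧸ 𝔐) := Fintype.ofFinite _
  letI : Field (absIntegers R K ⧸ 𝔐) := Ideal.Quotient.field 𝔐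
  -- `t ^ #(ℤ̄/𝔐) = t` in the finite field `ℤ̄/𝔐`, contradicting `exists_pow_sub_notMem`
  have hQ : 2 ≤ Fintype.card (absIntegers R K ⧸ 𝔐) := by
    have h1 : 1 < Fintype.card (absIntegers R K ⧸ 𝔐) := Fintype.one_lt_card
    omega
  obtain ⟨x, hx⟩ := absIntegers.exists_pow_sub_notMem (K := K) h𝔐.ne_top hQ
  apply hx
  rw [← Ideal.Quotient.eq_zero_iff_mem, map_sub, map_pow, FiniteField.pow_card, sub_self]

end Residue

end Literature.NumberTheory.GaloisRepresentations



end
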